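import Mathlib
import HarnessLib
import Summits.NavierStokesRegularity.NavierStokesRegularity.Theorems.TaylorModelRungThreeCertificateStageNumericsSound
import Summits.NavierStokesRegularity.NavierStokesRegularity.Theorems.TaylorModelRungThreeCertificateSoundField

/-!
# Crux K1b-DR (stmt-NavierStokesRegularity-23954), line `taylor-model` — certificate SOUNDNESS for the
# `StageNumerics` block, part 2: the TRUNCATION-DEFECT clause (DIST)

For a window target `(i, k)` the monomials of Tao's `quadTerm` (ε₀ = 1) have their factors on the shells
`k − μ₃ + μ₁, k − μ₃ + μ₂ ∈ {k−1, k, k+1}` (`sn_fShell_range`); the difference between the field of `y` and the field of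
the window truncation of `y` is the sum of the monomials with at least one factor OFF the window, each bounded by
`|coef|·B(k₁)·B(k₂)` with `B = M` on the window, `6/5·Cb·2^(3(Kb+1)/4) ≤ 6/5·Cb·r34U` on shell `−Kb−1` and
`√(10·Cg·2^(−7(Ka+1))) ≤ tv` on shell `Ka+1` (`sn_yBound`); under `CoefOK φ T` the real coefficient
`α·2^(5(k−μ₃)/2)` is `φ (coefAt)`, so the sum is `φ (defectK)`, and `η₀·2^(2k)·√(M_k²/2 + η₀W_k) ≤ φ (η₀·2^(2k)·rM_k)`;
`checkSN_defect` tests exactly `defectK + η₀·2^(2k)·rM_k ≤ δ·ω_k` (`sn_defect`).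

MODEL-lattice bookkeeping only (rung TL-M3); nothing here concerns the Navier–Stokes equations.
-/

-- the sub-problem namespace repeats the summit name by design (D-0017)
set_option linter.dupNamespace false

namespace Summit.NavierStokesRegularity.NavierStokesRegularity.Theorems.TaylorModelCert

open scoped BigOperators
open Literature.Analysis.FluidPDE.TaoCascade Literature.Analysis.FluidPDE.TaoCascade.TaylorChain

namespace CertTables

section Defect

variable {K : Type} [Field K] [LinearOrder K] {φ : K →+* ℝ} (hφ : Monotone φ) (T : CertTables K)
  {A : ReadoutAux K} {B : StageAux K}

/-- The factor shells of a monomial are within one shell of the target. [folklore] -/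
theorem sn_fShell_range (μi : ℕ) (hμ : μi < 4) (k : ℤ) :
    k - 1 ≤ fShell₁ μi k ∧ fShell₁ μi k ≤ k + 1 ∧ k - 1 ≤ fShell₂ μi k ∧ fShell₂ μi k ≤ k + 1 := by
  interval_cases μi <;> simp [fShell₁, fShell₂, shifts] <;> omega

/-- A triple sum over `Fin 4 × Fin 4 × S` is bounded termwise by a triple `range 4` sum in the table order.
[folklore] -/
theorem sn_abs_sum3_le (g : Fin 4 → Fin 4 → ℤ × ℤ × ℤ → ℝ) (G : ℕ → ℕ → ℕ → ℝ)
    (h : ∀ a < 4, ∀ b < 4, ∀ μi < 4,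
      |g ⟨a % 4, Nat.mod_lt _ (by omega)⟩ ⟨b % 4, Nat.mod_lt _ (by omega)⟩ (shifts.getD μi (0, 0, 0))| ≤ G a b μi) :
    |∑ a : Fin 4, ∑ b : Fin 4, ∑ μ ∈ shiftSet, g a b μ| ≤
      ∑ a ∈ Finset.range 4, ∑ b ∈ Finset.range 4, ∑ μi ∈ Finset.range 4, G a b μi := by
  rw [sum_fin4_eq]
  refine (Finset.abs_sum_le_sum_abs _ _).trans (Finset.sum_le_sum fun a ha => ?_)
  rw [sum_fin4_eq]
  refine (Finset.abs_sum_le_sum_abs _ _).trans (Finset.sum_le_sum fun b hb => ?_)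
  rw [sum_shiftSet_eq]
  refine (Finset.abs_sum_le_sum_abs _ _).trans (Finset.sum_le_sum fun μi hμ => ?_)
  exact h a (Finset.mem_range.1 ha) b (Finset.mem_range.1 hb) μi (Finset.mem_range.1 hμ)

include hφ

/-- `|y| ≤ φ yBound` on the factor shells `[−Kb−1, Ka+1]`, from the three hypotheses of the clause and the
surrogates. [folklore] -/
theorem sn_yBound (hB : T.checkStageAux A B = true) (y : Fin 4 → ℤ → ℝ)
    (hM : ∀ i k, -(T.toCertData φ).Kb ≤ k → k ≤ (T.toCertData φ).Ka → |y i k| ≤ (T.toCertData φ).M k)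
    (hlo : ∀ i, |y i (-(T.toCertData φ).Kb - 1)| ≤
      6 / 5 * ((T.toCertData φ).Cb * (2 : ℝ) ^ ((3 : ℝ) / 4 * (((T.toCertData φ).Kb : ℝ) + 1))))
    (hhi : ∀ i, |y i ((T.toCertData φ).Ka + 1)| ≤
      Real.sqrt (10 * (T.toCertData φ).Cg * (2 : ℝ) ^ (-(7 : ℝ) * (((T.toCertData φ).Ka : ℝ) + 1))))
    (a : Fin 4) {k₁ : ℤ} (hk₁ : -T.Kb - 1 ≤ k₁ ∧ k₁ ≤ T.Ka + 1) : |y a k₁| ≤ φ (T.yBound A B k₁) := by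
  obtain ⟨-, -, -, -, -, -, ⟨hr0, -⟩, -, ⟨-, -, hCb, -⟩, -⟩ := T.sn_aux hB
  unfold yBound
  by_cases hw : -T.Kb ≤ k₁ ∧ k₁ ≤ T.Ka
  · rw [if_pos hw]
    exact (hM a k₁ hw.1 hw.2).trans (le_of_eq (T.sn_M φ hw))
  · rw [if_neg hw]
    by_cases hl : k₁ = -T.Kb - 1
    · rw [if_pos hl, hl]
      have hr := T.sn_r34_le hφ hB
      have hCb' : 0 ≤ φ T.Cb := phi_nonneg hφ hCb
      calc |y a (-T.Kb - 1)| ≤ 6 / 5 * (φ T.Cb * (2 : ℝ) ^ ((3 : ℝ) / 4 * (((T.toCertData φ).Kb : ℝ) + 1))) :=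
            hlo a
        _ ≤ 6 / 5 * (φ T.Cb * φ B.r34U) := by gcongr
        _ = φ (6 / 5 * T.Cb * B.r34U) := by simp [map_mul, map_div₀, map_ofNat]; ring
    · have hh : k₁ = T.Ka + 1 := by omega
      rw [if_neg hl, if_pos hh, hh]
      exact (hhi a).trans (T.sn_tail_le hφ hB)

/-- Soundness of `checkSN_defect`: the truncation-defect clause (DIST) of `StageNumerics` at stage `j`. [folklore] -/
theorem sn_defect (hB : T.checkStageAux A B = true) (hco : T.CoefOK φ) (j : ℕ)
    (h : T.checkSN_defect j A B = true) :
    ∀ y : Fin 4 → ℤ → ℝ,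
      (∀ i k, -(T.toCertData φ).Kb ≤ k → k ≤ (T.toCertData φ).Ka → |y i k| ≤ (T.toCertData φ).M k) →
      (∀ i, |y i (-(T.toCertData φ).Kb - 1)| ≤
        6 / 5 * ((T.toCertData φ).Cb * (2 : ℝ) ^ ((3 : ℝ) / 4 * (((T.toCertData φ).Kb : ℝ) + 1)))) →
      (∀ i, |y i ((T.toCertData φ).Ka + 1)| ≤
        Real.sqrt (10 * (T.toCertData φ).Cg * (2 : ℝ) ^ (-(7 : ℝ) * (((T.toCertData φ).Ka : ℝ) + 1)))) →
      ∀ i k, -(T.toCertData φ).Kb ≤ k → k ≤ (T.toCertData φ).Ka →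
        |quadTerm 1 (T.toCertData φ).α (fun j' n (_ : ℝ) => y j' n) i k 0 -
            quadTerm 1 (T.toCertData φ).α
              (fun j' n (_ : ℝ) => if -(T.toCertData φ).Kb ≤ n ∧ n ≤ (T.toCertData φ).Ka then y j' n else 0) i k 0| +
          (T.toCertData φ).η₀ * (2 : ℝ) ^ ((2 : ℝ) * (k : ℝ)) *
            Real.sqrt ((1 / 2) * (T.toCertData φ).M k ^ 2 + (T.toCertData φ).η₀ * (T.toCertData φ).W k) ≤
        (T.toCertData φ).δ j * (T.toCertData φ).ω j k := by
  intro y hM hlo hhi i k hk1 hk2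
  have hk : -T.Kb ≤ k ∧ k ≤ T.Ka := ⟨hk1, hk2⟩
  obtain ⟨-, -, -, -, -, -, -, -, ⟨hη, -, -, -⟩, -⟩ := T.sn_aux hB
  -- the check at the coordinate of `(i, k)`
  simp only [checkSN_defect, allN_eq_true, decide_eq_true_eq] at h
  have hc := h (T.idx i k) (T.idx_lt_n i hk)
  rw [T.wi_idx i hk, T.wk_idx i hk, T.idx_mod i hk] at hc
  -- (i) the field defect is at most `φ (defectK)`
  set d := T.toCertData φ with hd
  have hyB := T.sn_yBound hφ hB y hM hlo hhi
  have hdef : |quadTerm 1 d.α (fun j' n (_ : ℝ) => y j' n) i k 0 -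
      quadTerm 1 d.α (fun j' n (_ : ℝ) => if -d.Kb ≤ n ∧ n ≤ d.Ka then y j' n else 0) i k 0| ≤
      φ (T.defectK A B i k) := by
    -- merge the two triple sums
    have hmerge : quadTerm 1 d.α (fun j' n (_ : ℝ) => y j' n) i k 0 -
        quadTerm 1 d.α (fun j' n (_ : ℝ) => if -d.Kb ≤ n ∧ n ≤ d.Ka then y j' n else 0) i k 0 =
        ∑ a : Fin 4, ∑ b : Fin 4, ∑ μ ∈ shiftSet,
          d.α a b i μ * (1 + 1 : ℝ) ^ ((5 : ℝ) * (k - μ.2.2) / 2) *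
            (y a (k - μ.2.2 + μ.1) * y b (k - μ.2.2 + μ.2.1) -
              (if -d.Kb ≤ k - μ.2.2 + μ.1 ∧ k - μ.2.2 + μ.1 ≤ d.Ka then y a (k - μ.2.2 + μ.1) else 0) *
                (if -d.Kb ≤ k - μ.2.2 + μ.2.1 ∧ k - μ.2.2 + μ.2.1 ≤ d.Ka then y b (k - μ.2.2 + μ.2.1) else 0)) := by
      simp only [quadTerm, ← Finset.sum_sub_distrib, ← mul_sub]
    rw [hmerge]
    have hK : φ (T.defectK A B i k) = ∑ a ∈ Finset.range 4, ∑ b ∈ Finset.range 4, ∑ μi ∈ Finset.range 4,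
        φ (if (-T.Kb ≤ fShell₁ μi k ∧ fShell₁ μi k ≤ T.Ka) ∧ (-T.Kb ≤ fShell₂ μi k ∧ fShell₂ μi k ≤ T.Ka) then 0
          else |T.coefAt ⟨a % 4, Nat.mod_lt _ (by omega)⟩ ⟨b % 4, Nat.mod_lt _ (by omega)⟩ i μi k| *
            T.yBound A B (fShell₁ μi k) * T.yBound A B (fShell₂ μi k)) := by
      simp only [defectK, phi_sumN]
    rw [hK]
    refine sn_abs_sum3_le _ _ fun a ha b hb μi hμ => ?_
    -- one monomial
    set a' : Fin 4 := ⟨a % 4, Nat.mod_lt _ (by omega)⟩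
    set b' : Fin 4 := ⟨b % 4, Nat.mod_lt _ (by omega)⟩
    have hs1 : k - (shifts.getD μi (0, 0, 0)).2.2 + (shifts.getD μi (0, 0, 0)).1 = fShell₁ μi k := rfl
    have hs2 : k - (shifts.getD μi (0, 0, 0)).2.2 + (shifts.getD μi (0, 0, 0)).2.1 = fShell₂ μi k := rfl
    have hKb : d.Kb = T.Kb := rfl
    have hKa : d.Ka = T.Ka := rfl
    rw [hs1, hs2, hKb, hKa]
    obtain ⟨h11, h12, h21, h22⟩ := sn_fShell_range μi hμ k
    have hr1 : -T.Kb - 1 ≤ fShell₁ μi k ∧ fShell₁ μi k ≤ T.Ka + 1 := ⟨by linarith, by linarith⟩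
    have hr2 : -T.Kb - 1 ≤ fShell₂ μi k ∧ fShell₂ μi k ≤ T.Ka + 1 := ⟨by linarith, by linarith⟩
    -- the real coefficient is `φ coefAt`
    have hcoef : d.α a' b' i (shifts.getD μi (0, 0, 0)) * (1 + 1 : ℝ) ^ ((5 : ℝ) * (k - (shifts.getD μi (0, 0, 0)).2.2) / 2) =
        φ (T.coefAt a' b' i μi k) := by
      rw [hco a' b' i μi k hμ hk1 hk2, hd, toCertData_α, shifts_getD μi hμ, if_pos hμ, one_add_one_eq_two]
    by_cases hboth : (-T.Kb ≤ fShell₁ μi k ∧ fShell₁ μi k ≤ T.Ka) ∧ (-T.Kb ≤ fShell₂ μi k ∧ fShell₂ μi k ≤ T.Ka)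
    · rw [if_pos hboth, if_pos hboth.1, if_pos hboth.2, sub_self, mul_zero, abs_zero, map_zero]
    · rw [if_neg hboth]
      have hzero : (if -T.Kb ≤ fShell₁ μi k ∧ fShell₁ μi k ≤ T.Ka then y a' (fShell₁ μi k) else 0) *
          (if -T.Kb ≤ fShell₂ μi k ∧ fShell₂ μi k ≤ T.Ka then y b' (fShell₂ μi k) else 0) = 0 := by
        rcases not_and_or.1 hboth with h1 | h2
        · rw [if_neg h1, zero_mul]
        · rw [if_neg h2, mul_zero]
      rw [hzero, sub_zero, hcoef, abs_mul, abs_mul, map_mul, map_mul, phi_abs hφ, mul_assoc |φ _|]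
      have hy1 := hyB a' hr1
      have hy2 := hyB b' hr2
      have hB1 : 0 ≤ φ (T.yBound A B (fShell₁ μi k)) := (abs_nonneg _).trans hy1
      exact mul_le_mul_of_nonneg_left (mul_le_mul hy1 hy2 (abs_nonneg _) hB1) (abs_nonneg _)
  -- (ii) the level term is at most `φ (η₀·2^(2k)·rM)`
  have hlev : d.η₀ * (2 : ℝ) ^ ((2 : ℝ) * (k : ℝ)) * Real.sqrt ((1 / 2) * d.M k ^ 2 + d.η₀ * d.W k) ≤
      φ (T.η₀ * (2 : K) ^ (2 * k) * vget B.rM (k + T.Kb).toNat) := by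
    have h2 : (2 : ℝ) ^ ((2 : ℝ) * (k : ℝ)) = φ ((2 : K) ^ (2 * k)) := by
      rw [map_zpow₀, map_ofNat]
      have : (2 : ℝ) * (k : ℝ) = ((2 * k : ℤ) : ℝ) := by push_cast; ring
      rw [this, Real.rpow_intCast]
    have hsq := T.sn_rM_le hφ hB (T.toNat_shell_lt_m hk)
    rw [hd, sn_η₀, T.sn_M φ hk, T.sn_W φ hk, map_mul, map_mul, ← h2, ← hd] at *
    have hη' : 0 ≤ φ T.η₀ := phi_nonneg hφ hη
    have h2' : 0 ≤ (2 : ℝ) ^ ((2 : ℝ) * (k : ℝ)) := by positivity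
    exact mul_le_mul_of_nonneg_left hsq (mul_nonneg hη' h2')
  -- (iii) assemble against the checked inequality
  have hω : d.ω j k = φ (T.wgt j (T.idx i k)) := T.omega_of_InW φ j i hk
  calc _ ≤ φ (T.defectK A B i k) + φ (T.η₀ * (2 : K) ^ (2 * k) * vget B.rM (k + T.Kb).toNat) :=
        add_le_add hdef hlev
    _ = φ (T.defectK A B i k + T.η₀ * (2 : K) ^ (2 * k) * vget B.rM (k + T.Kb).toNat) := by rw [map_add]
    _ ≤ φ ((T.stage j).δ * T.wgt j (T.idx i k)) := hφ hc
    _ = d.δ j * d.ω j k := by rw [map_mul, hω, hd, toCertData_δ]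

end Defect

end CertTables

end Summit.NavierStokesRegularity.NavierStokesRegularity.Theorems.TaylorModelCert
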